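import Mathlib
import HarnessLib
import Summits.HubbardSuperconductivity.HubbardSuperconductivity.Theorems.KLProgrammeC4aLoopIBPDefs

/-!
# Route `KLProgramme` — crux C4a, S3 (B4)-GENERIC — MONOTONE-WINDOW CALCULUS, part 2 («(B4)-GEN-WINDOW», the IDENTITY):
# `∫ w·Ψ^{(c)}(g) dφ = (−1)^c · ∫ (L_g^c w)·Ψ(g) dφ` for a weight supported in a window where the partner band `g` has no critical point

Cell `gate-hubbard-kl`, seat hubbard-kl-k3c3-p3 (g20; row «implicit-function / monotonicity route»).  Located brick for the (C)-closer lane c4a-1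
(stub (C) `stub_twoLeg_curvature` of `KLRegimeEngineV17F2`, stmt-HubbardSuperconductivity-20437), C4A-PLAN §24.4 (iii) / §24.6 (B4) / §24.10 last
paragraph: «IBP in φ is localized to the windows around φ_c (where 1/∂_φē ≤ 2/|T|) and the rest of the circle carries no small denominators».  After the
partition of unity of the loop circle, each window term of `∂_θ^i ∫_{(−π,π)} J(e,φ+θ)•Ψ(ē) dφ` has the shape `∫ w(φ) • Ψ^{(c)}(g φ) dφ` with a real
weight `w ∈ C^c` supported inside the window `(a,b)`, the partner band `g = ē(e,·;ρ,ϑ,θ) ∈ C^{c+1}` with `∂_φ g ≠ 0` on `[a,b]`, and `Ψ ∈ C^c` (the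
slice propagator product, values in `ℂ` — here any complete real normed space `E`).  On the window the loop angle is a `C^{c+1}` chart of the partner
LEVEL (inverse function theorem in one variable), `∂/∂(level) = (1/g′)∂_φ`, and its transpose is `L_g w = (w/g′)′` (`…C4aLoopIBPDefs.loopIBPOp`):

* §1 CLASS: `tsupport (L_g^r w) ⊆ tsupport w`; `w ∈ C^{n+r}`, `g ∈ C^{n+r+1}`, `g′ ≠ 0` on `[a,b]`, `tsupport w ⊆ (a,b)` ⟹ `L_g^r w ∈ C^n`
  (`contDiff_div_deriv`, `contDiff_loopIBPOp`, `contDiff_iterate_loopIBPOp`); outside `(a,b)` everything vanishes;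
* §2 ONE STEP: **`intervalIntegral_smul_deriv_comp_eq_neg`** `∫_{a..b} w φ • Ψ′(g φ) = −∫_{a..b} (L_g w) φ • Ψ(g φ)` (Mathlib's
  `integral_smul_deriv_eq_deriv_smul`, no boundary terms);
* §3 ITERATED: **`intervalIntegral_smul_iteratedDeriv_comp_eq`** `∫_{a..b} w φ • Ψ^{(c)}(g φ) = (−1)^c • ∫_{a..b} (L_g^c w) φ • Ψ(g φ)`;
* §4 SET-INTEGRAL FORM for the consumer's `∫ φ in Ioo (−π) π, …`: **`setIntegral_smul_iteratedDeriv_comp_eq`** on any measurable `s ⊇ (a,b)`.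

The BOUNDS (`|L_g^c w| ≤ loopIBPTable …`, `‖∫‖ ≤ T(c,0)·∫‖Ψ∘g‖`, the monotone substitution `∫ u(g) ≤ m⁻¹∫ u`) are `…C4aLoopIBPBounds`.  Carrier-free
(`g, w : ℝ → ℝ`, `Ψ : ℝ → E`); Mathlib + the definition file only; nothing is asserted about the Hubbard model.
References: FST II, CPAM 51 (1998) §3 (regularity of the self-energy by integration by parts along the Fermi curve); BGM 2006 §2.4
[cite: BenfattoGiulianiMastropietro2006].
-/

noncomputable section

namespace Summit.HubbardSuperconductivity.HubbardSuperconductivity.Theorems.C4a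

set_option linter.dupNamespace false -- summit = problem name (single-conjunct summit), D-0017

open Real Set Filter MeasureTheory intervalIntegral
open scoped Topology

variable {E : Type*} [NormedAddCommGroup E] [NormedSpace ℝ E] [CompleteSpace E]

/-! ## §1 The class `{C^n, tsupport ⊆ (a,b)}` is stable under `L_g` -/

section Class

variable {g w : ℝ → ℝ} {a b : ℝ}

/-- A weight supported in `(a,b)` vanishes off `(a,b)`. [folklore] -/
theorem apply_eq_zero_of_tsupport_subset (hsupp : tsupport w ⊆ Ioo a b) {x : ℝ} (hx : x ∉ Ioo a b) : w x = 0 :=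
  image_eq_zero_of_notMem_tsupport fun h => hx (hsupp h)

/-- `supp (w/g′) ⊆ supp w`. [folklore] -/
theorem support_div_deriv_subset (g w : ℝ → ℝ) : Function.support (fun s => w s / deriv g s) ⊆ Function.support w := by
  intro s hs
  rw [Function.mem_support] at hs ⊢
  intro h0
  exact hs (by rw [h0, zero_div])

/-- `tsupport (w/g′) ⊆ tsupport w`. [folklore] -/
theorem tsupport_div_deriv_subset (g w : ℝ → ℝ) : tsupport (fun s => w s / deriv g s) ⊆ tsupport w :=
  closure_mono (support_div_deriv_subset g w)

/-- `tsupport (L_g w) ⊆ tsupport w`. [folklore] -/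
theorem tsupport_loopIBPOp_subset (g w : ℝ → ℝ) : tsupport (loopIBPOp g w) ⊆ tsupport w :=
  (tsupport_deriv_subset (f := fun s => w s / deriv g s)).trans (tsupport_div_deriv_subset g w)

/-- `tsupport (L_g^r w) ⊆ tsupport w`. [folklore] -/
theorem tsupport_iterate_loopIBPOp_subset (g w : ℝ → ℝ) (r : ℕ) : tsupport ((loopIBPOp g)^[r] w) ⊆ tsupport w := by
  induction r generalizing w with
  | zero => exact subset_rfl
  | succ r ih => rw [Function.iterate_succ_apply]; exact (ih _).trans (tsupport_loopIBPOp_subset g w)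

/-- `L_g^r w` vanishes off `(a,b)` when `tsupport w ⊆ (a,b)`. [folklore] -/
theorem iterate_loopIBPOp_apply_eq_zero (hsupp : tsupport w ⊆ Ioo a b) (r : ℕ) {x : ℝ} (hx : x ∉ Ioo a b) :
    (loopIBPOp g)^[r] w x = 0 :=
  apply_eq_zero_of_tsupport_subset ((tsupport_iterate_loopIBPOp_subset g w r).trans hsupp) hx

/-- The cancelled product: `(w/g′)·g′ = w` EVERYWHERE when `g′ ≠ 0` on `[a,b] ⊇ tsupport w` (off `[a,b]` both sides vanish). [folklore] -/
theorem div_deriv_mul_deriv_eq (hg' : ∀ s ∈ Icc a b, deriv g s ≠ 0) (hsupp : tsupport w ⊆ Ioo a b) (x : ℝ) :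
    w x / deriv g x * deriv g x = w x := by
  by_cases h0 : deriv g x = 0
  · have hx : x ∉ Icc a b := fun hx => hg' x hx h0
    rw [apply_eq_zero_of_tsupport_subset hsupp fun h => hx (Ioo_subset_Icc_self h), zero_div, zero_mul]
  · exact div_mul_cancel₀ (w x) h0

/-- **SMOOTHNESS OF THE QUOTIENT**: `g ∈ C^{n+1}`, `g′ ≠ 0` on `[a,b]`, `w ∈ C^n`, `tsupport w ⊆ (a,b)` ⟹ `w/g′ ∈ C^n` (on `(a,b)` a quotient with
nonvanishing denominator; off `tsupport w` identically zero near each point). [folklore] -/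
theorem contDiff_div_deriv {n : ℕ} (hg : ContDiff ℝ (n + 1) g) (hg' : ∀ s ∈ Icc a b, deriv g s ≠ 0) (hw : ContDiff ℝ n w)
    (hsupp : tsupport w ⊆ Ioo a b) : ContDiff ℝ n (fun s => w s / deriv g s) := by
  have hdg : ContDiff ℝ n (deriv g) := by
    have h := hg.iterate_deriv' n 1
    simpa only [Function.iterate_one] using h
  refine contDiff_iff_contDiffAt.2 fun x => ?_
  by_cases hx : x ∈ Ioo a b
  · exact hw.contDiffAt.fun_div hdg.contDiffAt (hg' x (Ioo_subset_Icc_self hx))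
  · have h0 : w =ᶠ[𝓝 x] 0 := notMem_tsupport_iff_eventuallyEq.1 fun h => hx (hsupp h)
    have h1 : (fun s => w s / deriv g s) =ᶠ[𝓝 x] fun _ => (0 : ℝ) := h0.mono fun s hs => by
      simp only [Pi.zero_apply] at hs
      show w s / deriv g s = 0
      rw [hs, zero_div]
    exact contDiffAt_const.congr_of_eventuallyEq h1

/-- **`L_g` LOWERS THE CLASS BY ONE**: `g ∈ C^{n+2}`, `g′ ≠ 0` on `[a,b]`, `w ∈ C^{n+1}`, `tsupport w ⊆ (a,b)` ⟹ `L_g w ∈ C^n`. [folklore] -/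
theorem contDiff_loopIBPOp {n : ℕ} (hg : ContDiff ℝ (n + 2) g) (hg' : ∀ s ∈ Icc a b, deriv g s ≠ 0) (hw : ContDiff ℝ (n + 1) w)
    (hsupp : tsupport w ⊆ Ioo a b) : ContDiff ℝ n (loopIBPOp g w) := by
  have hq : ContDiff ℝ (n + 1) (fun s => w s / deriv g s) := contDiff_div_deriv (n := n + 1) hg hg' hw hsupp
  have h := hq.iterate_deriv' n 1
  rw [Function.iterate_one] at h
  rw [loopIBPOp_def]
  exact h

/-- **ITERATED CLASS**: `g ∈ C^{N+1}`, `g′ ≠ 0` on `[a,b]`, `w ∈ C^N`, `tsupport w ⊆ (a,b)`, `n + r ≤ N` ⟹ `L_g^r w ∈ C^n`. [folklore] -/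
theorem contDiff_iterate_loopIBPOp {N : ℕ} (hg : ContDiff ℝ (N + 1) g) (hg' : ∀ s ∈ Icc a b, deriv g s ≠ 0)
    (hw : ContDiff ℝ N w) (hsupp : tsupport w ⊆ Ioo a b) :
    ∀ r n : ℕ, n + r ≤ N → ContDiff ℝ n ((loopIBPOp g)^[r] w) := by
  intro r
  induction r with
  | zero =>
    intro n hn
    rw [Function.iterate_zero_apply]
    exact hw.of_le (by exact_mod_cast hn)
  | succ r ih =>
    intro n hn
    rw [Function.iterate_succ_apply']
    have hv : ContDiff ℝ (n + 1) ((loopIBPOp g)^[r] w) := by exact_mod_cast ih (n + 1) (by omega)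
    exact contDiff_loopIBPOp (hg.of_le (by exact_mod_cast (by omega : n + 2 ≤ N + 1))) hg' hv
      ((tsupport_iterate_loopIBPOp_subset g w r).trans hsupp)

/-- Continuity of `L_g^c w` under the class hypotheses at `N = c`. [folklore] -/
theorem continuous_iterate_loopIBPOp (c : ℕ) (hg : ContDiff ℝ (c + 1) g) (hg' : ∀ s ∈ Icc a b, deriv g s ≠ 0)
    (hw : ContDiff ℝ c w) (hsupp : tsupport w ⊆ Ioo a b) : Continuous ((loopIBPOp g)^[c] w) :=
  (contDiff_iterate_loopIBPOp hg hg' hw hsupp c 0 (by simp)).continuous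

end Class

/-! ## §2 One integration by parts, no boundary terms -/

section OneStep

variable {g w : ℝ → ℝ} {a b : ℝ}

/-- **ONE LOOP-ANGLE INTEGRATION BY PARTS**: `g ∈ C²`, `g′ ≠ 0` on `[a,b]`, `w ∈ C¹` with `tsupport w ⊆ (a,b)`, `Ψ ∈ C¹` ⟹
`∫_{a..b} w φ • Ψ′(g φ) dφ = −∫_{a..b} (L_g w) φ • Ψ(g φ) dφ`.  (`u = w/g′`, `v = Ψ ∘ g`, `u•v′ = w•Ψ′(g)`; `u(a) = u(b) = 0`.) [folklore] -/
theorem intervalIntegral_smul_deriv_comp_eq_neg (hg : ContDiff ℝ 2 g) (hg' : ∀ s ∈ Icc a b, deriv g s ≠ 0) (hw : ContDiff ℝ 1 w)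
    (hsupp : tsupport w ⊆ Ioo a b) {Ψ : ℝ → E} (hΨ : ContDiff ℝ 1 Ψ) :
    ∫ φ in a..b, w φ • deriv Ψ (g φ) = -∫ φ in a..b, loopIBPOp g w φ • Ψ (g φ) := by
  -- the two factors and their derivatives
  have hu : ContDiff ℝ 1 (fun s => w s / deriv g s) := contDiff_div_deriv (n := 1) hg hg' hw hsupp
  have hud : ∀ x, HasDerivAt (fun s => w s / deriv g s) (loopIBPOp g w x) x := fun x =>
    ((hu.differentiable one_ne_zero) x).hasDerivAt
  have hgd : ∀ x, HasDerivAt g (deriv g x) x := fun x => ((hg.differentiable two_ne_zero) x).hasDerivAt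
  have hΨd : ∀ y, HasDerivAt Ψ (deriv Ψ y) y := fun y => ((hΨ.differentiable one_ne_zero) y).hasDerivAt
  have hvd : ∀ x, HasDerivAt (fun s => Ψ (g s)) (deriv g x • deriv Ψ (g x)) x := fun x => (hΨd (g x)).scomp x (hgd x)
  -- continuity of the derivatives (for interval integrability)
  have hLc : Continuous (loopIBPOp g w) := by
    have h := hu.continuous_deriv le_rfl
    exact h
  have hv'c : Continuous fun x => deriv g x • deriv Ψ (g x) :=
    (hg.continuous_deriv (by norm_num)).smul ((hΨ.continuous_deriv le_rfl).comp hg.continuous)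
  have hibp := intervalIntegral.integral_smul_deriv_eq_deriv_smul (u := fun s => w s / deriv g s) (v := fun s => Ψ (g s))
    (fun x _ => hud x) (fun x _ => hvd x) (hLc.intervalIntegrable a b) (hv'c.intervalIntegrable a b)
  -- the integrand on the left is `w • Ψ′(g)`; the boundary terms vanish
  have hlhs : (fun x => (w x / deriv g x) • (deriv g x • deriv Ψ (g x))) = fun x => w x • deriv Ψ (g x) := by
    funext x; rw [smul_smul, div_deriv_mul_deriv_eq hg' hsupp x]
  have ha : w a / deriv g a = 0 := by
    rw [apply_eq_zero_of_tsupport_subset hsupp fun h => (lt_irrefl a) h.1, zero_div]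
  have hb : w b / deriv g b = 0 := by
    rw [apply_eq_zero_of_tsupport_subset hsupp fun h => (lt_irrefl b) h.2, zero_div]
  rw [hlhs, ha, hb, zero_smul, zero_smul, sub_zero, zero_sub] at hibp
  exact hibp

end OneStep

/-! ## §3 The iterated identity -/

section Iterated

variable {g w : ℝ → ℝ} {a b : ℝ}

/-- **ITERATED LOOP-ANGLE INTEGRATION BY PARTS**: `g ∈ C^{c+1}`, `g′ ≠ 0` on `[a,b]`, `w ∈ C^c` with `tsupport w ⊆ (a,b)`, `Ψ ∈ C^c` ⟹
`∫_{a..b} w φ • Ψ^{(c)}(g φ) dφ = (−1)^c • ∫_{a..b} (L_g^c w) φ • Ψ(g φ) dφ`.  Every derivative has left `Ψ`; the price is the operator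
`L_g = ∂_φ ∘ (1/g′)` applied `c` times to the weight (bounded in `…C4aLoopIBPBounds`). [folklore] -/
theorem intervalIntegral_smul_iteratedDeriv_comp_eq (c : ℕ) (hg : ContDiff ℝ (c + 1) g) (hg' : ∀ s ∈ Icc a b, deriv g s ≠ 0)
    (hw : ContDiff ℝ c w) (hsupp : tsupport w ⊆ Ioo a b) {Ψ : ℝ → E} (hΨ : ContDiff ℝ c Ψ) :
    ∫ φ in a..b, w φ • iteratedDeriv c Ψ (g φ) = (-1 : ℝ) ^ c • ∫ φ in a..b, (loopIBPOp g)^[c] w φ • Ψ (g φ) := by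
  induction c generalizing w Ψ with
  | zero => simp
  | succ c ih =>
    -- peel the innermost derivative: `Ψ^{(c+1)} = (Ψ′)^{(c)}`
    have hΨ' : ContDiff ℝ c (deriv Ψ) := by
      have h := hΨ.iterate_deriv' c 1
      simpa only [Function.iterate_one] using h
    have hstep1 : ∫ φ in a..b, w φ • iteratedDeriv (c + 1) Ψ (g φ) = ∫ φ in a..b, w φ • iteratedDeriv c (deriv Ψ) (g φ) := by
      simp only [iteratedDeriv_succ']
    rw [hstep1, ih (hg.of_le (by exact_mod_cast (by omega : c + 1 ≤ c + 1 + 1))) (hw.of_le (by exact_mod_cast (by omega : c ≤ c + 1)))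
      hsupp hΨ']
    -- one more integration by parts on the weight `L_g^c w ∈ C¹`
    have hLc : ContDiff ℝ 1 ((loopIBPOp g)^[c] w) := contDiff_iterate_loopIBPOp hg hg' hw hsupp c 1 (by omega)
    have hone := intervalIntegral_smul_deriv_comp_eq_neg (hg.of_le (by exact_mod_cast (by omega : 2 ≤ c + 1 + 1))) hg' hLc
      ((tsupport_iterate_loopIBPOp_subset g w c).trans hsupp) (hΨ.of_le (by exact_mod_cast (by omega : 1 ≤ c + 1)))
    rw [hone, Function.iterate_succ_apply', pow_succ, mul_neg_one, neg_smul, smul_neg]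

/-- The same with the sign moved: `∫_{a..b} (L_g^c w) φ • Ψ(g φ) dφ = (−1)^c • ∫_{a..b} w φ • Ψ^{(c)}(g φ) dφ`. [folklore] -/
theorem intervalIntegral_iterate_loopIBPOp_smul_comp_eq (c : ℕ) (hg : ContDiff ℝ (c + 1) g) (hg' : ∀ s ∈ Icc a b, deriv g s ≠ 0)
    (hw : ContDiff ℝ c w) (hsupp : tsupport w ⊆ Ioo a b) {Ψ : ℝ → E} (hΨ : ContDiff ℝ c Ψ) :
    ∫ φ in a..b, (loopIBPOp g)^[c] w φ • Ψ (g φ) = (-1 : ℝ) ^ c • ∫ φ in a..b, w φ • iteratedDeriv c Ψ (g φ) := by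
  rw [intervalIntegral_smul_iteratedDeriv_comp_eq c hg hg' hw hsupp hΨ, smul_smul, ← mul_pow]
  norm_num

end Iterated

/-! ## §4 Set-integral form (the consumer's `∫ φ in Ioo (−π) π, …`) -/

section SetIntegral

variable {w : ℝ → ℝ} {a b : ℝ}

omit [CompleteSpace E] in
/-- A window term over any measurable `s ⊇ (a,b)` is the interval integral over the window: for `tsupport w ⊆ (a,b) ⊆ s`, `a ≤ b`,
`∫_{s} w φ • F φ = ∫_{a..b} w φ • F φ`. [folklore] -/
theorem setIntegral_smul_eq_intervalIntegral_of_tsupport_subset {F : ℝ → E} {s : Set ℝ} (hs : MeasurableSet s) (hab : a ≤ b)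
    (hsub : Ioo a b ⊆ s) (hsupp : tsupport w ⊆ Ioo a b) :
    ∫ φ in s, w φ • F φ = ∫ φ in a..b, w φ • F φ := by
  have hzero : ∀ x ∈ s \ Ioo a b, w x • F x = 0 := fun x hx => by
    rw [apply_eq_zero_of_tsupport_subset hsupp hx.2, zero_smul]
  rw [setIntegral_eq_of_subset_of_forall_sdiff_eq_zero hs hsub hzero, intervalIntegral.integral_of_le hab,
    integral_Ioc_eq_integral_Ioo]

variable {g : ℝ → ℝ}

/-- **THE IDENTITY IN THE CONSUMER'S CURRENCY**: for any measurable `s ⊇ (a,b)` (e.g. `s = Ioo (−π) π`), `a ≤ b`, `g ∈ C^{c+1}` with `g′ ≠ 0` on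
`[a,b]`, `w ∈ C^c` with `tsupport w ⊆ (a,b)`, `Ψ ∈ C^c`:
`∫_{s} w φ • Ψ^{(c)}(g φ) dφ = (−1)^c • ∫_{s} (L_g^c w) φ • Ψ(g φ) dφ`. [folklore] -/
theorem setIntegral_smul_iteratedDeriv_comp_eq {s : Set ℝ} (hs : MeasurableSet s) (hab : a ≤ b) (hsub : Ioo a b ⊆ s) (c : ℕ)
    (hg : ContDiff ℝ (c + 1) g) (hg' : ∀ x ∈ Icc a b, deriv g x ≠ 0) (hw : ContDiff ℝ c w) (hsupp : tsupport w ⊆ Ioo a b)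
    {Ψ : ℝ → E} (hΨ : ContDiff ℝ c Ψ) :
    ∫ φ in s, w φ • iteratedDeriv c Ψ (g φ) = (-1 : ℝ) ^ c • ∫ φ in s, (loopIBPOp g)^[c] w φ • Ψ (g φ) := by
  rw [setIntegral_smul_eq_intervalIntegral_of_tsupport_subset hs hab hsub hsupp,
    setIntegral_smul_eq_intervalIntegral_of_tsupport_subset hs hab hsub ((tsupport_iterate_loopIBPOp_subset g w c).trans hsupp),
    intervalIntegral_smul_iteratedDeriv_comp_eq c hg hg' hw hsupp hΨ]

/-- The loop-circle instance: `s = Ioo (−π) π`. [folklore] -/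
theorem loopIntegral_smul_iteratedDeriv_comp_eq (hab : a ≤ b) (hsub : Ioo a b ⊆ Ioo (-π) π) (c : ℕ)
    (hg : ContDiff ℝ (c + 1) g) (hg' : ∀ x ∈ Icc a b, deriv g x ≠ 0) (hw : ContDiff ℝ c w) (hsupp : tsupport w ⊆ Ioo a b)
    {Ψ : ℝ → E} (hΨ : ContDiff ℝ c Ψ) :
    ∫ φ in Ioo (-π) π, w φ • iteratedDeriv c Ψ (g φ) = (-1 : ℝ) ^ c • ∫ φ in Ioo (-π) π, (loopIBPOp g)^[c] w φ • Ψ (g φ) :=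
  setIntegral_smul_iteratedDeriv_comp_eq measurableSet_Ioo hab hsub c hg hg' hw hsupp hΨ

end SetIntegral

end Summit.HubbardSuperconductivity.HubbardSuperconductivity.Theorems.C4a

end
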